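import Mathlib
import Literature.Analysis.FluidPDE.VectorCalculus
import Literature.Analysis.FluidPDE.DecayingSelfSimilarEulerProfile
import Summits.NavierStokesRegularity.NavierStokesRegularity.Theorems.UnthreadedDoorFluxStarvedDipoleSphereFrame
import Summits.NavierStokesRegularity.NavierStokesRegularity.Theorems.UnthreadedDoorFluxStarvedDipoleLoopLaw
import HarnessLib

/-!
# Route `UnthreadedDoor`, crux `PoloidalLiouville` (stmt-NavierStokesRegularity-1222), wall W1 — crux idea
# «flux-starved-dipoles» (ns-idea-15 g12/g13, `Cruxes/PoloidalLiouville/FluxStarvedDipoleSketch.lean`):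
# RADIAL VORTICITY IN THE MOVING FRAME and ZERO CIRCULATION OF UNTHREADED FIELDS AROUND LATITUDE CIRCLES
# (first brick of L0 `SphereTangentUnthreadedVanishes`)

With K1 closed (p838510) and the time-dependent lever landed (p838637), the crux card's corollaries `NonSolidDipolarShellAtRest(On)`
and C2 `DipolarWindowIrrotational` wait only on L0 `SphereTangentUnthreadedVanishes` (tangent + solenoidal + UNTHREADED on a shell
⇒ zero).  Its classical proof uses a surface stream function (`H¹(S²) = 0`); a kernel route without Hodge theory is: meridian
line-integral potential of the tangential field, whose azimuthal derivative is controlled by the RADIAL VORTICITY written in the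
moving frame, then a 3-D energy identity.  THIS FILE lands the first brick, which is also a stand-alone kinematic fact about the
crux hypothesis `⟪x − x₀, curl v⟫ = 0`:

* `hasDerivAt_azimuthal_meridian`, `hasDerivAt_meridional_latitude` — kinematic chain rules along the meridian / latitude circle
  of the frame `(n, e, n × e)`: `∂_θ(sin θ·u_φ)` and `∂_φ u_θ`;
* `radialVorticity_movingFrame` — `r sin θ·⟪curl u, ξ̂⟫ = ∂_θ(sin θ·u_φ) − ∂_φ u_θ` (Literature `inner_cross_curl_left` in the
  frame `(ξ̂, θ̂, φ̂)`, `θ̂ × φ̂ = ξ̂`);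
* `latitudeCirculation_eq_zero_of_unthreaded` — if `u ∈ C¹` is UNTHREADED on the sphere `S_r(x₀)` (`⟪y, curl u(x₀+y)⟫ = 0` for
  `‖y‖ = r`), then for every axis `n`, unit `e ⊥ n` and colatitude `θ`:
  `∫₀^{2π} sin θ·⟪u(x₀ + r cos θ·n + r sin θ·ρ̂(φ)), φ̂(φ)⟫ dφ = 0` — the circulation of `u` around EVERY latitude circle of
  EVERY axis vanishes (Stokes on polar caps, done as: `d/dθ` under the integral sign = `∮ ∂_φ u_θ dφ = 0`, and the circle
  degenerates at `θ = 0`).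

HONEST LABEL: kinematics of the unthreaded class (information-grade for W1, movement 0); L0, C2, K1′, `PoloidalLiouville` (1222), its
wall `stub_scalarLiouville` and the summit stay OPEN; NO Navier–Stokes regularity statement is proved.
`--supports stmt-NavierStokesRegularity-1222` (helper).  [folklore]
-/

noncomputable section

-- the summit and its single sub-problem share the name (CONVENTIONS §1)
set_option linter.dupNamespace false

open Set Filter Topology InnerProductSpace MeasureTheory
open scoped RealInnerProductSpace
open Literature.Analysis.FluidPDE
open Summit.NavierStokesRegularity.NavierStokesRegularity.Theorems.PoloidalLiouville.HorizonTower (E3)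
open Summit.NavierStokesRegularity.NavierStokesRegularity.Theorems.PoloidalLiouville.KinematicShadow (PointSource.cross_smul_right
  PointSource.cross_add_right PointSource.cross_self PointSource.cross_anticomm)

namespace Summit.NavierStokesRegularity.NavierStokesRegularity.Theorems.PoloidalLiouville.FluxStarvedDipole

/-! ### Kinematic chain rules along meridians and latitude circles -/

/-- Derivative of the rotating unit vector `ρ̂(φ) = cos φ·e + sin φ·f`: `dρ̂/dφ = φ̂ = −sin φ·e + cos φ·f`. [folklore] -/
theorem hasDerivAt_rhoHat (e f : E3) (φ : ℝ) :
    HasDerivAt (fun φ : ℝ => Real.cos φ • e + Real.sin φ • f) ((-Real.sin φ) • e + Real.cos φ • f) φ :=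
  ((Real.hasDerivAt_cos φ).smul_const e).add ((Real.hasDerivAt_sin φ).smul_const f)

/-- **Along a meridian**: `d/dθ [sin θ·⟪u(x₀ + r cos θ·n + r sin θ·ρ), p⟫] = cos θ·⟪u, p⟫ + sin θ·⟪Du[r θ̂], p⟫` for a fixed
vector `p` (`θ̂ = −sin θ·n + cos θ·ρ`). [folklore] -/
theorem hasDerivAt_azimuthal_meridian {u : E3 → E3} (hu : ContDiff ℝ 1 u) (x₀ n ρ p : E3) (r θ : ℝ) :
    HasDerivAt (fun θ : ℝ => Real.sin θ * ⟪u (x₀ + (r * Real.cos θ) • n + (r * Real.sin θ) • ρ), p⟫)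
      (Real.cos θ * ⟪u (x₀ + (r * Real.cos θ) • n + (r * Real.sin θ) • ρ), p⟫
        + Real.sin θ * ⟪fderiv ℝ u (x₀ + (r * Real.cos θ) • n + (r * Real.sin θ) • ρ)
            (r • ((-Real.sin θ) • n + Real.cos θ • ρ)), p⟫) θ := by
  have hβ : HasDerivAt (fun θ : ℝ => x₀ + (r * Real.cos θ) • n + (r * Real.sin θ) • ρ)
      (r • ((-Real.sin θ) • n + Real.cos θ • ρ)) θ := by
    have h1 : HasDerivAt (fun θ : ℝ => x₀ + (r * Real.cos θ) • n) ((r * -Real.sin θ) • n) θ :=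
      (((Real.hasDerivAt_cos θ).const_mul r).smul_const n).const_add x₀
    have h2 : HasDerivAt (fun θ : ℝ => (r * Real.sin θ) • ρ) ((r * Real.cos θ) • ρ) θ :=
      ((Real.hasDerivAt_sin θ).const_mul r).smul_const ρ
    exact (h1.add h2).congr_deriv (by module)
  have hU : HasDerivAt (fun θ : ℝ => u (x₀ + (r * Real.cos θ) • n + (r * Real.sin θ) • ρ))
      (fderiv ℝ u (x₀ + (r * Real.cos θ) • n + (r * Real.sin θ) • ρ) (r • ((-Real.sin θ) • n + Real.cos θ • ρ))) θ :=
    (hu.differentiable one_ne_zero _).hasFDerivAt.comp_hasDerivAt θ hβ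
  have hI := hU.inner ℝ (hasDerivAt_const θ p)
  simp only [inner_zero_right, zero_add] at hI
  have h := (Real.hasDerivAt_sin θ).mul hI
  exact h

/-- **Along a latitude circle**: `d/dφ ⟪u(γ(φ)), θ̂(φ)⟫ = ⟪Du[r sin θ·φ̂], θ̂⟫ + cos θ·⟪u, φ̂⟫` for the circle
`γ(φ) = x₀ + r cos θ·n + r sin θ·ρ̂(φ)` of the frame `(n, e, n × e)` (`θ̂(φ) = −sin θ·n + cos θ·ρ̂(φ)`, `dθ̂/dφ = cos θ·φ̂`).
[folklore] -/
theorem hasDerivAt_meridional_latitude {u : E3 → E3} (hu : ContDiff ℝ 1 u) (x₀ n e : E3) (r θ φ : ℝ) :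
    HasDerivAt (fun φ : ℝ => ⟪u (x₀ + (r * Real.cos θ) • n + (r * Real.sin θ) • (Real.cos φ • e + Real.sin φ • cross n e)),
        (-Real.sin θ) • n + Real.cos θ • (Real.cos φ • e + Real.sin φ • cross n e)⟫)
      (⟪u (x₀ + (r * Real.cos θ) • n + (r * Real.sin θ) • (Real.cos φ • e + Real.sin φ • cross n e)),
          Real.cos θ • ((-Real.sin φ) • e + Real.cos φ • cross n e)⟫
        + ⟪fderiv ℝ u (x₀ + (r * Real.cos θ) • n + (r * Real.sin θ) • (Real.cos φ • e + Real.sin φ • cross n e))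
            ((r * Real.sin θ) • ((-Real.sin φ) • e + Real.cos φ • cross n e)),
          (-Real.sin θ) • n + Real.cos θ • (Real.cos φ • e + Real.sin φ • cross n e)⟫) φ := by
  have hγ := hasDerivAt_latitudeCircle n e x₀ r (Real.cos θ) (Real.sin θ) φ
  have hU : HasDerivAt
      (fun φ : ℝ => u (x₀ + (r * Real.cos θ) • n + (r * Real.sin θ) • (Real.cos φ • e + Real.sin φ • cross n e)))
      (fderiv ℝ u (x₀ + (r * Real.cos θ) • n + (r * Real.sin θ) • (Real.cos φ • e + Real.sin φ • cross n e))
        ((r * Real.sin θ) • ((-Real.sin φ) • e + Real.cos φ • cross n e))) φ :=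
    (hu.differentiable one_ne_zero _).hasFDerivAt.comp_hasDerivAt φ hγ
  have hτ : HasDerivAt (fun φ : ℝ => (-Real.sin θ) • n + Real.cos θ • (Real.cos φ • e + Real.sin φ • cross n e))
      (Real.cos θ • ((-Real.sin φ) • e + Real.cos φ • cross n e)) φ := by
    have h := ((hasDerivAt_rhoHat e (cross n e) φ).const_smul (Real.cos θ)).const_add ((-Real.sin θ) • n)
    exact h
  exact hU.inner ℝ hτ

/-! ### Radial vorticity in the moving frame -/

/-- **RADIAL VORTICITY IN THE MOVING FRAME.**  At `x = x₀ + r cos θ·n + r sin θ·ρ` (orthonormal pair `(n, ρ)`, `p = n × ρ`,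
`ξ̂ = cos θ·n + sin θ·ρ`, `θ̂ = −sin θ·n + cos θ·ρ`): `r sin θ·⟪curl u(x), ξ̂⟫ = [cos θ·u_p + sin θ·⟪Du[r θ̂], p⟫] −
[⟪Du[r sin θ·p], θ̂⟫ + cos θ·u_p]` — the two brackets are `∂_θ(sin θ·u_φ)` and `∂_φ u_θ` of the previous lemmas
(`⟪curl u × θ̂, φ̂⟫ = ⟪φ̂, Du θ̂⟫ − ⟪θ̂, Du φ̂⟫`, Literature `inner_cross_curl_left`; `θ̂ × φ̂ = ξ̂`). [folklore] -/
theorem radialVorticity_movingFrame (u : E3 → E3) (x : E3) {n ρ : E3} (hn : ‖n‖ = 1) (hρ : ‖ρ‖ = 1)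
    (hnρ : ⟪n, ρ⟫ = 0) (r θ : ℝ) :
    r * Real.sin θ * ⟪curl u x, Real.cos θ • n + Real.sin θ • ρ⟫ =
      (Real.cos θ * ⟪u x, cross n ρ⟫
          + Real.sin θ * ⟪fderiv ℝ u x (r • ((-Real.sin θ) • n + Real.cos θ • ρ)), cross n ρ⟫)
        - (⟪fderiv ℝ u x ((r * Real.sin θ) • cross n ρ), (-Real.sin θ) • n + Real.cos θ • ρ⟫
          + ⟪u x, Real.cos θ • cross n ρ⟫) := by
  obtain ⟨hξ1, hτ1, hξτ, hp⟩ := movingFrame_facts hn hρ hnρ (Real.cos_sq_add_sin_sq θ)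
  -- `θ̂ × φ̂ = ξ̂`
  obtain ⟨-, -, -, -, hτp⟩ := pairFrame_facts hξ1 hτ1 hξτ
  rw [hp] at hτp
  have hcurl := inner_cross_curl_left u x ((-Real.sin θ) • n + Real.cos θ • ρ) (cross n ρ)
  rw [← inner_cross_right_eq_inner_cross_left, hτp] at hcurl
  rw [hcurl, map_smul, map_smul, real_inner_smul_left, real_inner_smul_left, real_inner_smul_right,
    real_inner_comm (cross n ρ) (fderiv ℝ u x ((-Real.sin θ) • n + Real.cos θ • ρ)),
    real_inner_comm ((-Real.sin θ) • n + Real.cos θ • ρ) (fderiv ℝ u x (cross n ρ))]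
  ring

/-! ### Zero circulation of unthreaded fields around latitude circles -/

/-- **UNTHREADED ⇒ ZERO CIRCULATION AROUND EVERY LATITUDE CIRCLE.**  Let `u ∈ C¹(ℝ³; ℝ³)` be UNTHREADED on the sphere
`S_r(x₀)`: `⟪y, curl u(x₀ + y)⟫ = 0` whenever `‖y‖ = r`.  Then for every unit axis `n`, unit `e ⊥ n` and colatitude `θ`,
`∫₀^{2π} sin θ·⟪u(x₀ + r cos θ·n + r sin θ·(cos φ·e + sin φ·(n × e))), −sin φ·e + cos φ·(n × e)⟫ dφ = 0` (the circulation
`r·(this)` of `u` around the latitude circle vanishes).  Proof: by `radialVorticity_movingFrame` and unthreadedness the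
`θ`-derivative of the integrand is `∂_φ u_θ`, whose integral over a period vanishes; differentiating under the integral sign
the circulation is constant in `θ`, and it is `0` at `θ = 0`. [folklore] -/
theorem latitudeCirculation_eq_zero_of_unthreaded {u : E3 → E3} (hu : ContDiff ℝ 1 u) (x₀ : E3) {r : ℝ} (hr : 0 < r)
    (hunthr : ∀ y : E3, ‖y‖ = r → ⟪y, curl u (x₀ + y)⟫ = 0) {n e : E3} (hn : ‖n‖ = 1) (he : ‖e‖ = 1)
    (hne : ⟪n, e⟫ = 0) (θ : ℝ) :
    ∫ φ in (0 : ℝ)..2 * Real.pi, Real.sin θ *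
        ⟪u (x₀ + (r * Real.cos θ) • n + (r * Real.sin θ) • (Real.cos φ • e + Real.sin φ • cross n e)),
          (-Real.sin φ) • e + Real.cos φ • cross n e⟫ = 0 := by
  -- the frame `(n, e, n × e)` and the rotating pair `(n, ρ̂(φ))`
  obtain ⟨hf1, hfn, hfe, hnf, -⟩ := pairFrame_facts hn he hne
  have hnf' : ⟪n, cross n e⟫ = 0 := by rw [real_inner_comm]; exact hfn
  have hef' : ⟪e, cross n e⟫ = 0 := by rw [real_inner_comm]; exact hfe
  have hρ1 : ∀ φ, ‖Real.cos φ • e + Real.sin φ • cross n e‖ = 1 := fun φ =>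
    (movingFrame_facts he hf1 hef' (Real.cos_sq_add_sin_sq φ)).1
  have hnρ : ∀ φ, ⟪n, Real.cos φ • e + Real.sin φ • cross n e⟫ = 0 := fun φ => by
    rw [inner_add_right, inner_smul_right, inner_smul_right, hne, hnf', mul_zero, mul_zero, add_zero]
  have hnρx : ∀ φ, cross n (Real.cos φ • e + Real.sin φ • cross n e) = (-Real.sin φ) • e + Real.cos φ • cross n e := by
    intro φ
    rw [PointSource.cross_add_right, PointSource.cross_smul_right, PointSource.cross_smul_right, hnf]
    module
  -- the integrand `F θ φ` and its `θ`-derivative `F' θ φ`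
  set F : ℝ → ℝ → ℝ := fun θ φ => Real.sin θ *
    ⟪u (x₀ + (r * Real.cos θ) • n + (r * Real.sin θ) • (Real.cos φ • e + Real.sin φ • cross n e)),
      (-Real.sin φ) • e + Real.cos φ • cross n e⟫ with hF
  set F' : ℝ → ℝ → ℝ := fun θ φ =>
    Real.cos θ * ⟪u (x₀ + (r * Real.cos θ) • n + (r * Real.sin θ) • (Real.cos φ • e + Real.sin φ • cross n e)),
        (-Real.sin φ) • e + Real.cos φ • cross n e⟫
      + Real.sin θ * ⟪fderiv ℝ u (x₀ + (r * Real.cos θ) • n + (r * Real.sin θ) • (Real.cos φ • e + Real.sin φ • cross n e))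
          (r • ((-Real.sin θ) • n + Real.cos θ • (Real.cos φ • e + Real.sin φ • cross n e))),
        (-Real.sin φ) • e + Real.cos φ • cross n e⟫ with hF'
  have hFd : ∀ θ φ, HasDerivAt (fun θ => F θ φ) (F' θ φ) θ := fun θ φ =>
    hasDerivAt_azimuthal_meridian hu x₀ n (Real.cos φ • e + Real.sin φ • cross n e)
      ((-Real.sin φ) • e + Real.cos φ • cross n e) r θ
  -- unthreadedness turns `F' θ ·` into the `φ`-derivative of `u_θ` along the circle
  have hF'eq : ∀ θ φ, HasDerivAt (fun φ : ℝ =>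
      ⟪u (x₀ + (r * Real.cos θ) • n + (r * Real.sin θ) • (Real.cos φ • e + Real.sin φ • cross n e)),
        (-Real.sin θ) • n + Real.cos θ • (Real.cos φ • e + Real.sin φ • cross n e)⟫) (F' θ φ) φ := by
    intro θ φ
    refine (hasDerivAt_meridional_latitude hu x₀ n e r θ φ).congr_deriv ?_
    have hV := radialVorticity_movingFrame u
      (x₀ + (r * Real.cos θ) • n + (r * Real.sin θ) • (Real.cos φ • e + Real.sin φ • cross n e)) hn (hρ1 φ) (hnρ φ) r θ
    rw [hnρx φ] at hV
    -- the point lies on `S_r(x₀)`, so the radial vorticity vanishes there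
    have hξ1 := (movingFrame_facts hn (hρ1 φ) (hnρ φ) (Real.cos_sq_add_sin_sq θ)).1
    have hy : (r * Real.cos θ) • n + (r * Real.sin θ) • (Real.cos φ • e + Real.sin φ • cross n e)
        = r • (Real.cos θ • n + Real.sin θ • (Real.cos φ • e + Real.sin φ • cross n e)) := by module
    have hnorm : ‖(r * Real.cos θ) • n + (r * Real.sin θ) • (Real.cos φ • e + Real.sin φ • cross n e)‖ = r := by
      rw [hy, norm_smul, hξ1, mul_one, Real.norm_of_nonneg hr.le]
    have h0 := hunthr _ hnorm
    rw [← add_assoc, hy, real_inner_smul_left, real_inner_comm] at h0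
    have key : r * Real.sin θ * ⟪curl u (x₀ + (r * Real.cos θ) • n + (r * Real.sin θ) •
        (Real.cos φ • e + Real.sin φ • cross n e)), Real.cos θ • n + Real.sin θ • (Real.cos φ • e + Real.sin φ • cross n e)⟫
        = 0 := by
      calc _ = Real.sin θ * (r * ⟪curl u (x₀ + (r * Real.cos θ) • n + (r * Real.sin θ) •
          (Real.cos φ • e + Real.sin φ • cross n e)), Real.cos θ • n + Real.sin θ • (Real.cos φ • e + Real.sin φ • cross n e)⟫) := by
            ring
        _ = 0 := by rw [h0, mul_zero]
    rw [key] at hV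
    simp only [hF']
    linarith
  -- continuity of `F`, `F'` in both variables
  have hfd : Continuous (fderiv ℝ u) := hu.continuous_fderiv one_ne_zero
  have huc : Continuous u := hu.continuous
  have hcontF : Continuous (Function.uncurry F) := by
    simp only [hF, Function.uncurry_def]
    fun_prop
  have hcontF' : Continuous (Function.uncurry F') := by
    simp only [hF', Function.uncurry_def]
    fun_prop
  have hsec : ∀ θ₀ : ℝ, Continuous fun φ : ℝ => (θ₀, φ) := fun θ₀ => continuous_const.prodMk continuous_id
  -- the `θ`-derivative of the circulation vanishes (differentiation under the integral sign)
  have hΓ : ∀ θ₀ : ℝ, HasDerivAt (fun θ => ∫ φ in (0 : ℝ)..2 * Real.pi, F θ φ) 0 θ₀ := by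
    intro θ₀
    have hK : IsCompact (Icc (θ₀ - 1) (θ₀ + 1) ×ˢ Icc (-(2 * Real.pi)) (2 * Real.pi)) :=
      isCompact_Icc.prod isCompact_Icc
    obtain ⟨M, hM⟩ := hK.exists_bound_of_continuousOn hcontF'.continuousOn
    have hint : ∫ φ in (0 : ℝ)..2 * Real.pi, F' θ₀ φ = 0 := by
      rw [intervalIntegral.integral_eq_sub_of_hasDerivAt (fun φ _ => hF'eq θ₀ φ)
        ((hcontF'.comp (hsec θ₀)).intervalIntegrable 0 (2 * Real.pi))]
      simp only [Real.cos_two_pi, Real.sin_two_pi, Real.cos_zero, Real.sin_zero, sub_self]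
    have hpi : 0 ≤ 2 * Real.pi := by positivity
    have h := intervalIntegral.hasDerivAt_integral_of_dominated_loc_of_deriv_le (μ := volume)
      (F := F) (F' := F') (x₀ := θ₀) (a := 0) (b := 2 * Real.pi) (bound := fun _ => M) (s := Icc (θ₀ - 1) (θ₀ + 1))
      (Icc_mem_nhds (by linarith) (by linarith))
      (Eventually.of_forall fun θ => (hcontF.comp (hsec θ)).aestronglyMeasurable)
      ((hcontF.comp (hsec θ₀)).intervalIntegrable 0 (2 * Real.pi))
      ((hcontF'.comp (hsec θ₀)).aestronglyMeasurable)
      (Eventually.of_forall fun φ hφ θ hθ => by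
        rw [Set.uIoc_of_le hpi] at hφ
        exact hM (θ, φ) ⟨hθ, ⟨by linarith [hφ.1], hφ.2⟩⟩)
      intervalIntegrable_const
      (Eventually.of_forall fun φ _ θ _ => hFd θ φ)
    rw [hint] at h
    exact h.2
  -- so the circulation is constant in `θ`, and it vanishes at `θ = 0`
  have hdiff : Differentiable ℝ fun θ => ∫ φ in (0 : ℝ)..2 * Real.pi, F θ φ := fun θ => (hΓ θ).differentiableAt
  have hconst := is_const_of_deriv_eq_zero hdiff (fun θ => (hΓ θ).deriv) θ 0
  rw [hconst]
  simp only [hF, Real.sin_zero, zero_mul, intervalIntegral.integral_zero]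

end Summit.NavierStokesRegularity.NavierStokesRegularity.Theorems.PoloidalLiouville.FluxStarvedDipole

end
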